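import Summits.BirchSwinnertonDyer.Rank1Residual.F1Sign2.SelfTwistAtTwo
import Literature.NumberTheory.EllipticCurves.HidaFamilyMembersProofs
import HarnessLib

/-!
# Cell `bsd-f1-sign2` — analytic lens (planner `-an` g20; MEMO-an v1.60 §23.3): AN-37 «THE SELF-TWIST COLUMN» — KERNEL GLUE
# (file 2 of 2 of the §23 port; file 1 = `F1Sign2/SelfTwistAtTwo.lean` = the statement rows, which carries the full typer filing record, the census,
# REF1-AUDIT §166/§167 verbatim and the REF2 status — one sketch, split in two by the typer for the gate's 400-line cap on files carrying proofs)

PROVED GLUE ONLY (ns `…F1Sign2.ANg20`, as the sibling; imports the sibling; std axioms re-checked by the typer; no def, no `sorry`, nothing asserted):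
the sketch's (`HOME/MEMO-an-data/g20/Sketch_v54.lean` a39538d6fa7bd8cc §23.3) `analyticRankOver_eq_one_of_le_one` and `one_le_analyticRankOver_of_sign` (AN-37s pins the
parity), `not_goodOrd_of_nuOne` and `goodSS_of_nuOne` (AN-37d♮⁺ ⟹ no good-ordinary member of `{ν = 1}` at `N ≡ 1 (mod 4)`), `squarefree_of_prime_level` —
VERBATIM; the sketch's two compositions through the DATA LAWS, re-proved by REF1 for the REPAIRED bodies C′ that the sibling files under -an's names
(`REF1-data/b166/lean/Probe166.lean` e22dd3268315ce67 `nuOneLevelNotOneModEight_of_ramified'` ↦ here `nuOneLevelNotOneModEight_of_ramified` : AN-37d♯′ → S37 → existence →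
AN-37d′ on the S37 slice; `REF1-data/b167/lean/Probe167.lean` 3b86ff5a7c61f84c `nuOneLevelNotOneModEight'_of_supersingular'` ↦ here `nuOneLevelNotOneModEight_of_supersingular` :
AN-37d♮′ → S37♭ → AN-37d′; proofs verbatim with `hΔ` threaded, REF1's primes dropped since -an's names now denote C′); and REF1's sorry-free extras from
Probe167: `hasGoodReductionAt_two_of_prime_level` (prime `N ≡ 1 (mod 4)` ⟹ good at 2, tree `hasGoodReductionAtPrime_of_not_dvd_conductorNorm`),
`not_goodSS_of_one_mod_eight` (S37♭ ⟹ no supersingular member at `N ≡ 1 (8)` on the slice), `delta_pos_of_sameQuadraticResolventAtTwo` (sameK ⟹ `0 < W.Δ` —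
the structural remark behind the uniform repair), plus the typer's one-line composition `goodSS_of_nuOne_primeLevel` (AN-37d♮⁺ + sameK ⟹ AN-37d♮′'s
conclusion outright at prime `N ≡ 1 (mod 4)`: REF1's `nuOneSupersingular'_of_fourDvd` WITHOUT its «sameK automatic at prime level» branch, which REF1 left as
a `sorry` (Mestre–Oesterlé) and which is therefore NOT carried).  Not carried either: REF1's `…_of_typed` lemmas (they quantify over the killed bodies).
PARTITION: none moved; beyond-print theorem: no; BSD not proved; no item closed.
bears_on: `stmt-BirchSwinnertonDyer-23715` `RankOneAtTwoBigImageOddLocal` (class `{ν = 1}`, prime level).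
-/
namespace Summit.BirchSwinnertonDyer.Rank1Residual.F1Sign2.ANg20

open Literature.NumberTheory.EllipticCurves Literature.NumberTheory.EllipticCurves.ModularForms UpperHalfPlane
open Summit.BirchSwinnertonDyer.Rank1Residual.F1Sign2 Summit.BirchSwinnertonDyer.Rank1Residual.F1Sign2.ANg17
open Summit.BirchSwinnertonDyer.Rank1Residual.F1Sign2.ANg18 Summit.BirchSwinnertonDyer.Rank1Residual.F1Sign2.ANg19
open Summit.BirchSwinnertonDyer.BirchSwinnertonDyer.Theorems.RankOneAtTwoOneDoor
open scoped Classical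

noncomputable section

/-! ### §23.3 Kernel glue (std axioms) -/

/-- AN-37s pins the parity: on the slice an analytic rank `≤ 1` over `F₃` is exactly `1`. -/
theorem analyticRankOver_eq_one_of_le_one (hS : CubicTwoDivisionFieldOddAnalyticRankAtTwo)
    (W : WeierstrassCurve ℚ) [W.IsElliptic] [W.IsGloballyMinimal] [NeZero (W.conductorNorm ℤ)]
    (hsq : Squarefree (W.conductorNorm ℤ)) (hΔ : 0 < W.Δ) (h2 : NoRationalTwoTorsion W) (hK : SameQuadraticResolventAtTwo W)
    (F : Type) [Field F] [NumberField F] (hF : IsCubicTwoDivisionField W F) (hle : W.analyticRankOver F ≤ 1) :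
    W.analyticRankOver F = 1 := by
  have hodd := hS W hsq hΔ h2 hK F hF
  obtain ⟨k, hk⟩ := hodd
  omega

/-- AN-37s on the even-rank sibling slice: the analytic rank over `F₃` is positive (the `L`-function side of AN-37r). -/
theorem one_le_analyticRankOver_of_sign (hS : CubicTwoDivisionFieldOddAnalyticRankAtTwo)
    (W : WeierstrassCurve ℚ) [W.IsElliptic] [W.IsGloballyMinimal] [NeZero (W.conductorNorm ℤ)]
    (hsq : Squarefree (W.conductorNorm ℤ)) (hΔ : 0 < W.Δ) (h2 : NoRationalTwoTorsion W) (hK : SameQuadraticResolventAtTwo W)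
    (F : Type) [Field F] [NumberField F] (hF : IsCubicTwoDivisionField W F) :
    1 ≤ W.analyticRankOver F := by
  obtain ⟨k, hk⟩ := hS W hsq hΔ h2 hK F hF
  omega

/-- AN-37d♯ + S37 (+ existence of `F₃`) ⟹ AN-37d, on the slice where S37 applies (`Δ > 0`, sameK, globally minimal model) — for the REPAIRED bodies C′ filed in the sibling
(REF1 §166's re-proof `nuOneLevelNotOneModEight_of_ramified'`, verbatim with `hΔ` threaded; -an's theorem name kept). [kernel glue] -/
theorem nuOneLevelNotOneModEight_of_ramified (hR : NuOneTwoDivisionFieldRamifiedAtTwo)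
    (hU : TwoDivisionFieldUnramifiedAtTwoOfOneModEight) (hE : CubicTwoDivisionFieldExists)
    (W : WeierstrassCurve ℚ) [W.IsElliptic] [W.IsGloballyMinimal] [NeZero (W.conductorNorm ℤ)]
    (hN : Nat.Prime (W.conductorNorm ℤ)) (hΔ : 0 < W.Δ) (h2 : NoRationalTwoTorsion W) (hK : SameQuadraticResolventAtTwo W)
    (Dt : ModularParametrizationData W (W.conductorNorm ℤ)) (hF : IsFrickeEigen (W.conductorNorm ℤ) Dt.f 1) (h0 : modularSymbol Dt.f 0 = 0)
    (hν : Dt.modularDegree % 4 = 2) : W.conductorNorm ℤ % 8 ≠ 1 := by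
  intro h8
  obtain ⟨F, _, _, hFF⟩ := hE W h2
  exact hU W hN h8 hΔ h2 hK F hFF (hR W hN hΔ h2 Dt hF h0 hν F hFF)

/-- Kernel glue: AN-37d♮ + S37♭ ⟹ AN-37d (`ν = 1 ⟹ N ≢ 1 (mod 8)` on `Δ > 0`) for the REPAIRED bodies C′ filed in the sibling (REF1 §167's re-proof
`nuOneLevelNotOneModEight'_of_supersingular'`, = the sketch's glue with `hΔ` threaded; -an's theorem name kept). -/
theorem nuOneLevelNotOneModEight_of_supersingular (hS : NuOneSupersingularAtTwoOfOneModFour) (h5 : SupersingularAtTwoLevelFiveModEightOfSameK)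
    (W : WeierstrassCurve ℚ) [W.IsElliptic] [W.IsGloballyMinimal] [NeZero (W.conductorNorm ℤ)]
    (hN : Nat.Prime (W.conductorNorm ℤ)) (hΔ : 0 < W.Δ) (h2 : NoRationalTwoTorsion W) (hK : SameQuadraticResolventAtTwo W)
    (Dt : ModularParametrizationData W (W.conductorNorm ℤ)) (hF : IsFrickeEigen (W.conductorNorm ℤ) Dt.f 1) (h0 : modularSymbol Dt.f 0 = 0)
    (hν : Dt.modularDegree % 4 = 2) : W.conductorNorm ℤ % 8 ≠ 1 := by
  intro h8
  have h4 : W.conductorNorm ℤ % 4 = 1 := by omega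
  have h5' := h5 W hN hΔ h2 hK (hS W hN h4 hΔ h2 Dt hF h0 hν)
  omega

/-- Kernel glue: AN-37d♮⁺ ⟹ on `{ν = 1}` at `N ≡ 1 (mod 4)` the curve is NOT good ordinary at 2 (so, having good reduction at the odd prime
level, it is supersingular — AN-37d♮ up to the dichotomy `good = ordinary ⊔ supersingular`, which is definitional unfolding of `GoodOrd/GoodSS`). -/
theorem not_goodOrd_of_nuOne (h : FourDvdModularDegreeOfUnramifiedAtTwo)
    (W : WeierstrassCurve ℚ) [W.IsElliptic] [W.IsGloballyMinimal] [NeZero (W.conductorNorm ℤ)]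
    (hN : Nat.Prime (W.conductorNorm ℤ)) (h4 : W.conductorNorm ℤ % 4 = 1) (hΔ : 0 < W.Δ) (h2 : NoRationalTwoTorsion W)
    (hK : SameQuadraticResolventAtTwo W) (Dt : ModularParametrizationData W (W.conductorNorm ℤ)) (hν : Dt.modularDegree % 4 = 2) :
    ¬ Literature.NumberTheory.EllipticCurves.Rank1Residual.GoodOrd W 2 := by
  intro hord
  have h4d := h W hN h4 hΔ h2 hK hord Dt
  omega

/-- Kernel glue: AN-37d♮⁺ ⟹ AN-37d♮, given good reduction at 2 (the definitional dichotomy). -/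
theorem goodSS_of_nuOne (h : FourDvdModularDegreeOfUnramifiedAtTwo)
    (W : WeierstrassCurve ℚ) [W.IsElliptic] [W.IsGloballyMinimal] [NeZero (W.conductorNorm ℤ)]
    (hN : Nat.Prime (W.conductorNorm ℤ)) (h4 : W.conductorNorm ℤ % 4 = 1) (hΔ : 0 < W.Δ) (h2 : NoRationalTwoTorsion W)
    (hK : SameQuadraticResolventAtTwo W) (hgood : W.HasGoodReductionAtPrime 2)
    (Dt : ModularParametrizationData W (W.conductorNorm ℤ)) (hν : Dt.modularDegree % 4 = 2) :
    Literature.NumberTheory.EllipticCurves.Rank1Residual.GoodSS W 2 := by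
  have hno := not_goodOrd_of_nuOne h W hN h4 hΔ h2 hK Dt hν
  unfold Literature.NumberTheory.EllipticCurves.Rank1Residual.GoodOrd at hno
  unfold Literature.NumberTheory.EllipticCurves.Rank1Residual.GoodSS
  by_contra hc
  exact hno ⟨hgood, fun hd => hc ⟨hgood, hd⟩⟩

/-- Prime level is squarefree level (bookkeeping used to feed AN-37s into AN-37b's frame). -/
theorem squarefree_of_prime_level (N : ℕ) (hN : Nat.Prime N) : Squarefree N := hN.squarefree

/-! ### REF1 §167 extras (VERBATIM from `REF1-data/b167/lean/Probe167.lean` 3b86ff5a7c61f84c, sorry-free) and one typer composition -/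

/-- At prime level `N ≡ 1 (mod 4)` the curve has good reduction at `2` (tree: `hasGoodReductionAtPrime_of_not_dvd_conductorNorm`). -/
theorem hasGoodReductionAt_two_of_prime_level (W : WeierstrassCurve ℚ) [W.IsElliptic]
    (hN : Nat.Prime (W.conductorNorm ℤ)) (h4 : W.conductorNorm ℤ % 4 = 1) : W.HasGoodReductionAtPrime 2 := by
  haveI : Fact (Nat.Prime 2) := ⟨Nat.prime_two⟩
  refine Literature.NumberTheory.EllipticCurves.hasGoodReductionAtPrime_of_not_dvd_conductorNorm W ?_
  intro h2
  have := (Nat.prime_dvd_prime_iff_eq Nat.prime_two hN).mp h2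
  omega

/-- S37♭ makes S37-type conclusions CFT-free: on the slice, `N ≡ 1 (mod 8)` excludes supersingular reduction at 2. -/
theorem not_goodSS_of_one_mod_eight (h5 : SupersingularAtTwoLevelFiveModEightOfSameK)
    (W : WeierstrassCurve ℚ) [W.IsElliptic] [W.IsGloballyMinimal] [NeZero (W.conductorNorm ℤ)]
    (hN : Nat.Prime (W.conductorNorm ℤ)) (h8 : W.conductorNorm ℤ % 8 = 1) (hΔ : 0 < W.Δ) (h2 : NoRationalTwoTorsion W)
    (hK : SameQuadraticResolventAtTwo W) : ¬ Literature.NumberTheory.EllipticCurves.Rank1Residual.GoodSS W 2 := by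
  intro hss
  have := h5 W hN hΔ h2 hK hss
  omega

/-- REF1 §167 structural remark: the sibling binder `SameQuadraticResolventAtTwo W` (`Δ = N·q²`, `q ≠ 0`) already forces `0 < W.Δ` — so the
uniform repair of the four killed data laws is equivalently «add sameK», and in S37 / S37♭ / AN-37d♮⁺ / AN-37s the binder `0 < W.Δ` is redundant. -/
theorem delta_pos_of_sameQuadraticResolventAtTwo (W : WeierstrassCurve ℚ) [NeZero (W.conductorNorm ℤ)]
    (hK : SameQuadraticResolventAtTwo W) : 0 < W.Δ := by
  obtain ⟨q, hq, hΔ⟩ := hK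
  have hN : (0 : ℚ) < (W.conductorNorm ℤ : ℚ) := by exact_mod_cast Nat.pos_of_ne_zero (NeZero.ne _)
  have hq2 : (0 : ℚ) < q ^ 2 := by positivity
  rw [hΔ]; exact mul_pos hN hq2

/-- Typer's composition (REF1 §167 `nuOneSupersingular'_of_fourDvd`, the sorry-FREE branch): AN-37d♮⁺ + sameK ⟹ the conclusion of AN-37d♮′ OUTRIGHT at
prime `N ≡ 1 (mod 4)` — the good-reduction binder of `goodSS_of_nuOne` is discharged by `hasGoodReductionAt_two_of_prime_level`; REF1's other branch
(«sameK is automatic at prime level», Mestre–Oesterlé 1989) carried a `sorry` and is NOT filed. -/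
theorem goodSS_of_nuOne_primeLevel (h : FourDvdModularDegreeOfUnramifiedAtTwo)
    (W : WeierstrassCurve ℚ) [W.IsElliptic] [W.IsGloballyMinimal] [NeZero (W.conductorNorm ℤ)]
    (hN : Nat.Prime (W.conductorNorm ℤ)) (h4 : W.conductorNorm ℤ % 4 = 1) (hΔ : 0 < W.Δ) (h2 : NoRationalTwoTorsion W)
    (hK : SameQuadraticResolventAtTwo W) (Dt : ModularParametrizationData W (W.conductorNorm ℤ)) (hν : Dt.modularDegree % 4 = 2) :
    Literature.NumberTheory.EllipticCurves.Rank1Residual.GoodSS W 2 :=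
  goodSS_of_nuOne h W hN h4 hΔ h2 hK (hasGoodReductionAt_two_of_prime_level W hN h4) Dt hν

end

end Summit.BirchSwinnertonDyer.Rank1Residual.F1Sign2.ANg20
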